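import Mathlib

/-!
# Pólya–Szegő: polynomials non-negative on the half-line `[0, ∞)` (weak form)

A real polynomial `P` of degree `≤ 2S + 1` which is non-negative on `[0, ∞)` is of the form
`P = Σᵢ fᵢ² + X · Σᵢ gᵢ²` with finitely many real polynomials `fᵢ, gᵢ` of degree `≤ S`
(`polyaSzego_halfLine`). Pólya and Szegő prove the sharp form with two squares in each of the
two sums; here any finite number of squares is allowed (the same number `m` in both sums, padding
with zero polynomials being harmless), which is all that duality arguments for truncated
Stieltjes moment problems need. On the way:

* `exists_sum_sq_of_forall_eval_nonneg` — a real polynomial `R` with `R ≥ 0` on `ℝ` is a finite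
  sum of squares `Σᵢ hᵢ²` of real polynomials with `2 · deg hᵢ ≤ deg R`. Proof by induction on
  the degree: `|R| = R` attains its minimum `c = R(x₀) ≥ 0` (`Polynomial.exists_forall_norm_le`);
  `R − c ≥ 0` has a double root at `x₀` (`X_sub_C_sq_dvd_sub_C_eval`, via `R'(x₀) = 0`), so
  `R − c = (X − x₀)² · R₁` with `R₁ ≥ 0` on `ℝ` (`eval_nonneg_of_X_sub_C_sq_mul_nonneg`) and
  `deg R₁ = deg R − 2`; then `R = Σᵢ ((X − x₀) hᵢ)² + (√c)²`.
* `polyaSzego_halfLine` — `R := P(X²) = expand ℝ 2 P` is `≥ 0` on `ℝ`, hence `R = Σᵢ hᵢ²` with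
  `deg hᵢ ≤ deg P ≤ 2S + 1`. Split into even and odd parts, `hᵢ = Aᵢ(X²) + X · Bᵢ(X²)` with
  `Aᵢ = contract 2 hᵢ`, `Bᵢ = contract 2 (divX hᵢ)` of degree `≤ S`
  (`expand_contract_add_X_mul_expand`); then
  `P(X²) = (Σᵢ (Aᵢ² + X Bᵢ²))(X²) + X · (Σᵢ 2AᵢBᵢ)(X²)` (`sum_sq_expand_add_X_mul_expand`) and
  comparing even coefficients (`eq_of_expand_two_eq_add`) gives `P = Σᵢ Aᵢ² + X · Σᵢ Bᵢ²`.

## References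

* G. Pólya, G. Szegő, *Problems and Theorems in Analysis II*, Springer (1976), Part VI, §6,
  Problem 45 (polynomials positive on the half-line; two squares in each sum). [folklore]
* M. Marshall, *Positive Polynomials and Sums of Squares*, Math. Surveys Monogr. 146, AMS (2008),
  §1.2 (univariate sums of squares) and Prop. 2.7.3 (natural description of `[0, ∞)`). [folklore]
-/

noncomputable section

open Polynomial Finset Filter
open scoped BigOperators Topology

namespace Literature.Algebra.Polynomial

/-! ### Non-negative polynomials on the real line are finite sums of squares -/

/-- If `(X − a)² · T ≥ 0` on `ℝ` then `T ≥ 0` on `ℝ`: clear at `x ≠ a`, and at `a` by continuity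
(if `T(x) < 0` then `T < 0` near `x`, forcing `(y − a)² = 0` for all `y` near `x`). [folklore] -/
theorem eval_nonneg_of_X_sub_C_sq_mul_nonneg {T : ℝ[X]} {a : ℝ}
    (h : ∀ x : ℝ, 0 ≤ ((X - C a) ^ 2 * T).eval x) (x : ℝ) : 0 ≤ T.eval x := by
  by_contra hneg
  rw [not_le] at hneg
  have hev : ∀ᶠ y in 𝓝 x, T.eval y < 0 := (T.continuous.tendsto x).eventually_lt_const hneg
  have hroot : ∀ᶠ y in 𝓝 x, y ∈ {y | (X - C a).IsRoot y} := hev.mono fun y hy => by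
    have h1 := h y
    rw [eval_mul, eval_pow] at h1
    have hsq : ((X - C a).eval y) ^ 2 = 0 :=
      le_antisymm (by nlinarith [sq_nonneg ((X - C a).eval y)]) (sq_nonneg _)
    exact pow_eq_zero_iff two_ne_zero |>.mp hsq
  exact X_sub_C_ne_zero a (eq_zero_of_infinite_isRoot _ (infinite_of_mem_nhds x hroot))

/-- At a global minimum point `x₀` of a real polynomial `R` on `ℝ`, `(X − x₀)²` divides
`R − R(x₀)` (the root `x₀` of `R − R(x₀)` is also a root of its derivative). [folklore] -/
theorem X_sub_C_sq_dvd_sub_C_eval {R : ℝ[X]} {x₀ : ℝ} (hmin : ∀ y : ℝ, R.eval x₀ ≤ R.eval y) :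
    (X - C x₀) ^ 2 ∣ R - C (R.eval x₀) := by
  have hloc : IsLocalMin (fun x => R.eval x) x₀ := Filter.Eventually.of_forall fun y => hmin y
  have hder : R.derivative.eval x₀ = 0 := by
    have := hloc.deriv_eq_zero
    rwa [Polynomial.deriv] at this
  have hroot : (R - C (R.eval x₀)).IsRoot x₀ := by simp
  obtain ⟨P₁, hP₁⟩ := dvd_iff_isRoot.mpr hroot
  have hder' : (R - C (R.eval x₀)).derivative.eval x₀ = 0 := by
    rw [derivative_sub, derivative_C, sub_zero, hder]
  rw [hP₁, derivative_mul, derivative_sub, derivative_X, derivative_C, sub_zero, one_mul,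
    eval_add, eval_mul, eval_sub, eval_X, eval_C, sub_self, zero_mul, add_zero] at hder'
  obtain ⟨P₂, hP₂⟩ := dvd_iff_isRoot.mpr hder'
  rw [hP₁, hP₂, ← mul_assoc, ← pow_two]
  exact dvd_mul_right _ _

/-- A constant polynomial which is non-negative (at `0`) is the square of a constant. [folklore] -/
theorem exists_sum_sq_of_natDegree_eq_zero {R : ℝ[X]} (h0 : R.natDegree = 0)
    (h : ∀ x : ℝ, 0 ≤ R.eval x) :
    ∃ (m : ℕ) (g : ℕ → ℝ[X]), (∀ i < m, 2 * (g i).natDegree ≤ R.natDegree) ∧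
      R = ∑ i ∈ Finset.range m, (g i) ^ 2 := by
  refine ⟨1, fun _ => C (Real.sqrt (R.coeff 0)), fun i _ => by simp, ?_⟩
  rw [Finset.sum_range_one, ← C_pow, Real.sq_sqrt, ← eq_C_of_natDegree_eq_zero h0]
  rw [coeff_zero_eq_eval_zero]
  exact h 0

/-- **A real polynomial which is non-negative on `ℝ` is a finite sum of squares** `Σᵢ hᵢ²` of real
polynomials with `2 · deg hᵢ ≤ deg R` (induction on the degree through the minimum point).
[folklore] -/
theorem exists_sum_sq_of_forall_eval_nonneg (R : ℝ[X]) (h : ∀ x : ℝ, 0 ≤ R.eval x) :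
    ∃ (m : ℕ) (g : ℕ → ℝ[X]), (∀ i < m, 2 * (g i).natDegree ≤ R.natDegree) ∧
      R = ∑ i ∈ Finset.range m, (g i) ^ 2 := by
  suffices H : ∀ (n : ℕ) (R : ℝ[X]), R.natDegree ≤ n → (∀ x : ℝ, 0 ≤ R.eval x) →
      ∃ (m : ℕ) (g : ℕ → ℝ[X]), (∀ i < m, 2 * (g i).natDegree ≤ R.natDegree) ∧
        R = ∑ i ∈ Finset.range m, (g i) ^ 2 from H _ R le_rfl h
  intro n
  induction n with
  | zero => exact fun R hR hpos => exists_sum_sq_of_natDegree_eq_zero (Nat.le_zero.mp hR) hpos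
  | succ n ih =>
    intro R hR hpos
    rcases Nat.eq_zero_or_pos R.natDegree with h0 | hdeg
    · exact exists_sum_sq_of_natDegree_eq_zero h0 hpos
    -- the minimum `c = R(x₀) ≥ 0` of `R = |R|`
    obtain ⟨x₀, hx₀⟩ := R.exists_forall_norm_le
    have hmin : ∀ y, R.eval x₀ ≤ R.eval y := fun y => by
      have := hx₀ y
      rwa [Real.norm_of_nonneg (hpos x₀), Real.norm_of_nonneg (hpos y)] at this
    -- `R - c = (X - x₀)² R₁` with `R₁ ≥ 0` of degree `deg R - 2`
    obtain ⟨R₁, hR₁⟩ := X_sub_C_sq_dvd_sub_C_eval hmin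
    have hR₁pos : ∀ x, 0 ≤ R₁.eval x :=
      eval_nonneg_of_X_sub_C_sq_mul_nonneg (a := x₀) fun x => by
        rw [← hR₁, eval_sub, eval_C]; linarith [hmin x]
    have hR₁ne : R₁ ≠ 0 := by
      rintro rfl
      rw [mul_zero, sub_eq_zero] at hR₁
      rw [hR₁, natDegree_C] at hdeg
      exact lt_irrefl _ hdeg
    have hdegR : R.natDegree = R₁.natDegree + 2 := by
      rw [← natDegree_sub_C (a := R.eval x₀), hR₁,
        natDegree_mul (pow_ne_zero _ (X_sub_C_ne_zero x₀)) hR₁ne, natDegree_pow,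
        natDegree_X_sub_C]
      ring
    -- induction hypothesis for `R₁`, then `R = Σ ((X - x₀) gᵢ)² + (√c)²`
    obtain ⟨m, g, hg, hsum⟩ := ih R₁ (by omega) hR₁pos
    refine ⟨m + 1, fun i => if i < m then (X - C x₀) * g i else C (Real.sqrt (R.eval x₀)), ?_, ?_⟩
    · intro i _
      dsimp only
      split_ifs with him
      · have h1 : ((X - C x₀) * g i).natDegree ≤ 1 + (g i).natDegree :=
          natDegree_mul_le.trans (by rw [natDegree_X_sub_C])
        have h2 := hg i him
        omega
      · simp
    · have hcongr : ∑ i ∈ Finset.range m,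
          (if i < m then (X - C x₀) * g i else C (Real.sqrt (R.eval x₀))) ^ 2 =
            ∑ i ∈ Finset.range m, ((X - C x₀) * g i) ^ 2 :=
        Finset.sum_congr rfl fun i hi => by rw [if_pos (Finset.mem_range.mp hi)]
      rw [Finset.sum_range_succ]
      dsimp only
      rw [if_neg (lt_irrefl m), hcongr]
      simp_rw [mul_pow]
      rw [← Finset.mul_sum, ← hsum, ← C_pow, Real.sq_sqrt (hpos x₀), ← hR₁]
      ring

/-! ### Even and odd parts: `h = A(X²) + X · B(X²)` -/

/-- Odd coefficients of `A(X²)` vanish. [folklore] -/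
theorem coeff_expand_two_odd (A : ℝ[X]) (k : ℕ) : (expand ℝ 2 A).coeff (2 * k + 1) = 0 := by
  rw [coeff_expand two_pos, if_neg (by omega)]

/-- Even coefficients of `X · B(X²)` vanish. [folklore] -/
theorem coeff_X_mul_expand_two_even (B : ℝ[X]) (k : ℕ) :
    (X * expand ℝ 2 B).coeff (2 * k) = 0 := by
  rcases k with _ | k
  · exact coeff_X_mul_zero _
  · rw [show 2 * (k + 1) = 2 * k + 1 + 1 by ring, coeff_X_mul, coeff_expand_two_odd]

/-- The `(2k+1)`-st coefficient of `X · B(X²)` is the `k`-th coefficient of `B`. [folklore] -/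
theorem coeff_X_mul_expand_two_odd (B : ℝ[X]) (k : ℕ) :
    (X * expand ℝ 2 B).coeff (2 * k + 1) = B.coeff k := by
  rw [coeff_X_mul, coeff_expand_mul' two_pos]

/-- Even coefficients of `A(X²) + X · B(X²)` are the coefficients of `A`. [folklore] -/
theorem coeff_expand_add_X_mul_expand_even (A B : ℝ[X]) (k : ℕ) :
    (expand ℝ 2 A + X * expand ℝ 2 B).coeff (2 * k) = A.coeff k := by
  rw [coeff_add, coeff_expand_mul' two_pos, coeff_X_mul_expand_two_even, add_zero]

/-- Odd coefficients of `A(X²) + X · B(X²)` are the coefficients of `B`. [folklore] -/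
theorem coeff_expand_add_X_mul_expand_odd (A B : ℝ[X]) (k : ℕ) :
    (expand ℝ 2 A + X * expand ℝ 2 B).coeff (2 * k + 1) = B.coeff k := by
  rw [coeff_add, coeff_expand_two_odd, coeff_X_mul_expand_two_odd, zero_add]

/-- Uniqueness of the even part: if `P(X²) = T(X²) + X · U(X²)` then `P = T`. [folklore] -/
theorem eq_of_expand_two_eq_add (P T U : ℝ[X])
    (h : expand ℝ 2 P = expand ℝ 2 T + X * expand ℝ 2 U) : P = T := by
  ext k
  rw [← coeff_expand_mul' two_pos P k, h, coeff_expand_add_X_mul_expand_even]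

/-- **Even/odd decomposition** `h = A(X²) + X · B(X²)` with `A = contract 2 h` (the even-indexed
coefficients) and `B = contract 2 (divX h)` (the odd-indexed coefficients). [folklore] -/
theorem expand_contract_add_X_mul_expand (h : ℝ[X]) :
    expand ℝ 2 (contract 2 h) + X * expand ℝ 2 (contract 2 (divX h)) = h := by
  ext n
  obtain ⟨k, rfl | rfl⟩ := Nat.even_or_odd' n
  · rw [coeff_expand_add_X_mul_expand_even, coeff_contract two_ne_zero, mul_comm]
  · rw [coeff_expand_add_X_mul_expand_odd, coeff_contract two_ne_zero, coeff_divX, mul_comm]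

/-- Degree of the even part: `deg h ≤ 2S + 1 ⟹ deg (contract 2 h) ≤ S`. [folklore] -/
theorem natDegree_contract_two_le {h : ℝ[X]} {S : ℕ} (hd : h.natDegree ≤ 2 * S + 1) :
    (contract 2 h).natDegree ≤ S := by
  rw [natDegree_le_iff_coeff_eq_zero]
  intro N hN
  rw [coeff_contract two_ne_zero]
  exact coeff_eq_zero_of_natDegree_lt (by omega)

/-- Degree of the odd part: `deg h ≤ 2S + 1 ⟹ deg (contract 2 (divX h)) ≤ S`. [folklore] -/
theorem natDegree_contract_two_divX_le {h : ℝ[X]} {S : ℕ} (hd : h.natDegree ≤ 2 * S + 1) :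
    (contract 2 (divX h)).natDegree ≤ S := by
  rw [natDegree_le_iff_coeff_eq_zero]
  intro N hN
  rw [coeff_contract two_ne_zero, coeff_divX]
  exact coeff_eq_zero_of_natDegree_lt (by omega)

/-- `(A(X²) + X B(X²))² = (A² + X B²)(X²) + X · (2AB)(X²)`. [folklore] -/
theorem sq_expand_add_X_mul_expand (A B : ℝ[X]) :
    (expand ℝ 2 A + X * expand ℝ 2 B) ^ 2 =
      expand ℝ 2 (A ^ 2 + X * B ^ 2) + X * expand ℝ 2 (2 * A * B) := by
  simp only [map_add, map_mul, map_pow, expand_X, map_ofNat]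
  ring

/-- `Σᵢ (Aᵢ(X²) + X Bᵢ(X²))² = (Σᵢ (Aᵢ² + X Bᵢ²))(X²) + X · (Σᵢ 2AᵢBᵢ)(X²)`. [folklore] -/
theorem sum_sq_expand_add_X_mul_expand (m : ℕ) (A B : ℕ → ℝ[X]) :
    ∑ i ∈ Finset.range m, (expand ℝ 2 (A i) + X * expand ℝ 2 (B i)) ^ 2 =
      expand ℝ 2 (∑ i ∈ Finset.range m, ((A i) ^ 2 + X * (B i) ^ 2)) +
        X * expand ℝ 2 (∑ i ∈ Finset.range m, 2 * A i * B i) := by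
  simp_rw [sq_expand_add_X_mul_expand, map_sum, Finset.mul_sum, ← Finset.sum_add_distrib]

/-! ### The half-line -/

/-- **Pólya–Szegő on the half-line (weak form).** A real polynomial `P` of degree `≤ 2S + 1`
which is non-negative on `[0, ∞)` is `Σᵢ fᵢ² + X · Σᵢ gᵢ²` for finitely many real polynomials
`fᵢ, gᵢ` of degree `≤ S`. [folklore] -/
theorem polyaSzego_halfLine (S : ℕ) (P : Polynomial ℝ) (hdeg : P.natDegree ≤ 2 * S + 1)
    (hpos : ∀ x : ℝ, 0 ≤ x → 0 ≤ P.eval x) :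
    ∃ (m : ℕ) (f g : ℕ → Polynomial ℝ), (∀ i < m, (f i).natDegree ≤ S ∧ (g i).natDegree ≤ S) ∧
      P = ∑ i ∈ Finset.range m, (f i) ^ 2 + Polynomial.X * ∑ i ∈ Finset.range m, (g i) ^ 2 := by
  -- `R := P(X²) ≥ 0` on `ℝ` is a sum of squares `Σ hᵢ²`, `deg hᵢ ≤ deg P ≤ 2S + 1`
  have hR : ∀ x : ℝ, 0 ≤ (expand ℝ 2 P).eval x := fun x => by
    rw [expand_eval]
    exact hpos _ (sq_nonneg x)
  obtain ⟨m, h, hh, hsum⟩ := exists_sum_sq_of_forall_eval_nonneg _ hR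
  rw [natDegree_expand] at hh
  refine ⟨m, fun i => contract 2 (h i), fun i => contract 2 (divX (h i)), fun i hi => ?_, ?_⟩
  · have hdi : (h i).natDegree ≤ 2 * S + 1 := by have := hh i hi; omega
    exact ⟨natDegree_contract_two_le hdi, natDegree_contract_two_divX_le hdi⟩
  · -- `P(X²) = Σ (Aᵢ(X²) + X Bᵢ(X²))² = (Σ Aᵢ² + X Σ Bᵢ²)(X²) + X · (Σ 2AᵢBᵢ)(X²)`
    apply eq_of_expand_two_eq_add _ _
      (∑ i ∈ Finset.range m, 2 * contract 2 (h i) * contract 2 (divX (h i)))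
    rw [hsum, Finset.mul_sum, ← Finset.sum_add_distrib, ← sum_sq_expand_add_X_mul_expand]
    exact Finset.sum_congr rfl fun i _ => by rw [expand_contract_add_X_mul_expand]

end Literature.Algebra.Polynomial
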